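import Summits.AtomisticToContinuum.FouriersLaw.Theorems.HonestZwanzigNetworkReductionLimits
import Summits.AtomisticToContinuum.FouriersLaw.Theorems.HonestZwanzigOrthogonalOhmFeshbachIdentities

/-!
# `PositiveMemory` (crux stmt-AtomisticToContinuum-12694, route `HonestZwanzig`):
# the existence guard of the conclusion, and fixed-`N` existence of the orthogonal DC responses
# modulo non-degeneracy of `G(0⁺)` (negative-side support, crux-disprover seat gen 3;
# from `Cruxes/PositiveMemory/Disproof.lean` §6)

`PositiveMemory` concludes `∀ ρ, Tendsto (s ↦ schur_s(j_b, J)) (𝓝[>] 0) (𝓝 ρ) → k₀ ≤ ρ`: the floor is asserted only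
for limits that EXIST. Consequently (§1) every refutation of the crux — and of every strengthening of the same shape
(`R = 0`, `k₀` uniform in `T` or `γ`, the bulk backflow floor of line `Sketch`) — must PRODUCE a limit of the
orthogonal-dynamics response `s ↦ schur_s(j_b, J)` of an anharmonic chain at some fixed `N`; the two refuted slices on
record (`T = 0`, phantom bond) are exactly the two places where that function is identically zero.

§2 supplies the missing fixed-`N` existence statement, modulo ONE explicit non-degeneracy hypothesis (the planner's
"FixedNLap: `G(0⁺)` invertible", NOT DECOMPOSED YET in the route): writing `lap_0(f,g) := ∫₀^∞ corr(f,g)` and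
`G₀ := [lap_0(e_x, e_y)]_{x,y}` (all finite: `corr(f,g) ∈ L¹(0,∞)` for admissible `f, g` by the landed
`FeshbachIdentities` package, CEHR exponential mixing at fixed `N`),
* `tendsto_lap_of_adm` — `lap_s(f,g) → lap_0(f,g)` as `s ↓ 0` for all admissible `f, g` (dominated convergence);
* `tendsto_inv_G` — if `det G₀ ≠ 0` then `(G s)⁻¹ → G₀⁻¹` entrywise (continuity of matrix inversion);
* `tendsto_schur_of_det_ne_zero` — hence `schur_s(f,g) → schur₀(f,g) := lap_0(f,g) − lap_0(f,e)·G₀⁻¹·lap_0(e,g)`;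
* `tendsto_schur_bond` — the canonical instance: at every admissible parameter point, `T > 0`, `N ≥ 2` with
  `det G₀ ≠ 0`, EVERY orthogonal DC response `ρ_b = lim_{s↓0} schur_s(j_b, J)` exists and equals the explicit
  finite-`N` number `schur₀(j_b, J)` — the Schur complement of the matrix of time-INTEGRATED equilibrium correlations,
  which is what equilibrium MD measures.

§3 turns this into the existence-free form of the crux and its kill switch:
* `not_positiveMemory_of_witness` — the shape every refutation must deliver (one admissible point; for all `k₀ > 0`,
  `R`: some `N`, an `R`-bulk bond and a limit `ρ < k₀`);
* `not_positiveMemory_of_schur₀_witness` — modulo `det G₀ ≠ 0` at the witnessing `N`, a SMALL VALUE of the explicit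
  number `schur₀(j_b, J)` on bulk bonds kills the crux (no limit to be produced any more);
* `positiveMemory_iff_schur₀Floor` — under fixed-`N` non-degeneracy at every admissible point, `PositiveMemory` is
  EQUIVALENT to the existence-free floor `k₀ ≤ schur₀(j_b, J)` on bulk bonds (uniqueness of limits in the `NeBot`
  filter `𝓝[>] 0`).

Moral. The crux is "`N`-uniform positivity of an explicit finite-`N` Schur complement of Green–Kubo-type integrals"
plus the fixed-`N` lemma `det G₀ ≠ 0` (`G₀` is symmetric positive SEMI-definite as the limit of the positive definite
`G(s)`, `s > 0`; definiteness is a hypoelliptic non-degeneracy statement — `ξᵀG₀ξ = γT·Σ_{b∈∂}‖∂_{p_b}(−L)⁻¹h̄‖²`,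
`h = Σξ_xe_x` — expected at every `N`, unproved). No refutation of the crux is possible before a limit is produced, and
none is expected after: given crux #2 the floor follows from the conjunct (`OrthogonalOhm → FouriersLaw → PositiveMemory`,
line `Sketch` v9). This file does NOT refute the crux and introduces no definition.
-/

noncomputable section

open MeasureTheory Finset Real Set Filter Topology
open Literature.MathematicalPhysics.KineticTheory.HeatConduction
open Summit.AtomisticToContinuum.FouriersLaw.Theorems.HonestZwanzig.NetworkReduction

namespace Summit.AtomisticToContinuum.FouriersLaw.Theorems.PositiveMemory.Negative.ExistenceBarrier

/-! ## §2 Fixed-`N` limits `s ↓ 0` for admissible observables (gadgets as implicit variables) -/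

section Package

variable {ω₂ lam β γ : ℝ} {N : ℕ} {T : ℝ}
  {Adm : (PhaseSpace N → ℝ) → Prop}
  {corr : (PhaseSpace N → ℝ) → (PhaseSpace N → ℝ) → ℝ → ℝ}
  {lap : ℝ → (PhaseSpace N → ℝ) → (PhaseSpace N → ℝ) → ℝ}
  {e : Fin N → PhaseSpace N → ℝ}
  {G : ℝ → Matrix (Fin N) (Fin N) ℝ}
  {schur : ℝ → (PhaseSpace N → ℝ) → (PhaseSpace N → ℝ) → ℝ}
  (hAdm : ∀ f, Adm f ↔ (Continuous f ∧ ∃ A : ℝ, ∀ z,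
    |f z| ≤ A * Real.exp ((pinnedChain ω₂ lam β γ).hamiltonian N z / (8 * T))))
  (hlap : ∀ s f g, lap s f g = ∫ t in Set.Ioi (0 : ℝ), Real.exp (-(s * t)) * corr f g t)
  (he : ∀ x z, e x z = z.2 x ^ 2 / 2 + (pinnedChain ω₂ lam β γ).U (z.1 x) +
    ∑ j : Fin N, ((if j.val = x.val + 1 then (pinnedChain ω₂ lam β γ).V (z.1 j - z.1 x) / 2 else 0) +
      (if x.val = j.val + 1 then (pinnedChain ω₂ lam β γ).V (z.1 x - z.1 j) / 2 else 0)))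
  (hG : ∀ s x y, G s x y = lap s (e x) (e y))
  (hschur : ∀ s f g, schur s f g = lap s f g - ∑ x, ∑ y, lap s f (e x) * (G s)⁻¹ x y * lap s (e y) g)
  (hL1 : ∀ f g : PhaseSpace N → ℝ, Adm f → Adm g → IntegrableOn (corr f g) (Set.Ioi 0))
  (hω : 0 < ω₂) (hl : 0 ≤ lam) (hβ : 0 ≤ β) (hT : 0 < T)

include hlap hL1 in
/-- **`s ↓ 0` in the Laplace transform of an admissible pair** (dominated convergence, `corr(f,g) ∈ L¹(0,∞)`):
`lap_s(f,g) → ∫₀^∞ corr(f,g)`. [folklore] -/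
theorem tendsto_lap_of_adm {f g : PhaseSpace N → ℝ} (hf : Adm f) (hg : Adm g) :
    Tendsto (fun s => lap s f g) (nhdsWithin (0 : ℝ) (Set.Ioi 0))
      (nhds (∫ t in Set.Ioi (0 : ℝ), corr f g t)) := by
  have hI : IntegrableOn (corr f g) (Set.Ioi 0) := hL1 f g hf hg
  have hfun : (fun s => lap s f g) = fun s => ∫ t in Set.Ioi (0 : ℝ), Real.exp (-(s * t)) * corr f g t :=
    funext fun s => hlap s f g
  rw [hfun]
  refine tendsto_integral_filter_of_dominated_convergence (fun t => ‖corr f g t‖) ?_ ?_ hI.norm ?_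
  · exact Eventually.of_forall fun s =>
      ((by fun_prop : Continuous fun t : ℝ => Real.exp (-(s * t))).aestronglyMeasurable).mul
        hI.aestronglyMeasurable
  · filter_upwards [self_mem_nhdsWithin] with s hs
    filter_upwards [ae_restrict_mem measurableSet_Ioi] with t ht
    rw [norm_mul, Real.norm_eq_abs, abs_of_pos (Real.exp_pos _)]
    have h1 : Real.exp (-(s * t)) ≤ 1 := by
      rw [← Real.exp_zero]
      exact Real.exp_le_exp.mpr (by nlinarith [mul_pos (show (0:ℝ) < s from hs) (show (0:ℝ) < t from ht)])
    calc Real.exp (-(s * t)) * ‖corr f g t‖ ≤ 1 * ‖corr f g t‖ :=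
        mul_le_mul_of_nonneg_right h1 (norm_nonneg _)
      _ = ‖corr f g t‖ := one_mul _
  · refine Eventually.of_forall fun t => ?_
    have hc : Continuous fun s : ℝ => Real.exp (-(s * t)) * corr f g t := by fun_prop
    have := (hc.tendsto 0).mono_left (nhdsWithin_le_nhds (s := Set.Ioi (0 : ℝ)))
    simpa using this

include hAdm hlap he hG hL1 hω hl hβ hT in
/-- `G(s) → G₀ := [∫₀^∞ corr(e_x, e_y)]` entrywise as `s ↓ 0`. [folklore] -/
theorem tendsto_G_apply (x y : Fin N) :
    Tendsto (fun s => G s x y) (nhdsWithin (0 : ℝ) (Set.Ioi 0))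
      (nhds (∫ t in Set.Ioi (0 : ℝ), corr (e x) (e y) t)) := by
  have hfun : (fun s => G s x y) = fun s => lap s (e x) (e y) := funext fun s => hG s x y
  rw [hfun]
  exact tendsto_lap_of_adm hlap hL1 (adm_e Adm hAdm e he hω hl hβ hT x) (adm_e Adm hAdm e he hω hl hβ hT y)

include hAdm hlap he hG hL1 hω hl hβ hT in
/-- `G(s) → G₀` in the matrix (product) topology. [folklore] -/
theorem tendsto_G (G₀ : Matrix (Fin N) (Fin N) ℝ)
    (hG₀ : ∀ x y, G₀ x y = ∫ t in Set.Ioi (0 : ℝ), corr (e x) (e y) t) :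
    Tendsto G (nhdsWithin (0 : ℝ) (Set.Ioi 0)) (nhds G₀) := by
  refine tendsto_pi_nhds.2 fun x => tendsto_pi_nhds.2 fun y => ?_
  rw [hG₀]
  exact tendsto_G_apply hAdm hlap he hG hL1 hω hl hβ hT x y

include hAdm hlap he hG hL1 hω hl hβ hT in
/-- **Continuity of inversion at a non-degenerate limit**: if `det G₀ ≠ 0` then `(G s)⁻¹ → G₀⁻¹` entrywise as
`s ↓ 0` (so `(G s)⁻¹` is eventually the honest inverse and has a limit). [folklore] -/
theorem tendsto_inv_G (G₀ : Matrix (Fin N) (Fin N) ℝ)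
    (hG₀ : ∀ x y, G₀ x y = ∫ t in Set.Ioi (0 : ℝ), corr (e x) (e y) t) (hdet : G₀.det ≠ 0) (x y : Fin N) :
    Tendsto (fun s => (G s)⁻¹ x y) (nhdsWithin (0 : ℝ) (Set.Ioi 0)) (nhds (G₀⁻¹ x y)) := by
  have hc : ContinuousAt Ring.inverse G₀.det := by
    rw [Ring.inverse_eq_inv']
    exact continuousAt_inv₀ hdet
  have h : Tendsto (fun s => (G s)⁻¹) (nhdsWithin (0 : ℝ) (Set.Ioi 0)) (nhds G₀⁻¹) :=
    (continuousAt_matrix_inv G₀ hc).tendsto.comp (tendsto_G hAdm hlap he hG hL1 hω hl hβ hT G₀ hG₀)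
  have hx : Tendsto (fun s => (G s)⁻¹ x) (nhdsWithin (0 : ℝ) (Set.Ioi 0)) (nhds (G₀⁻¹ x)) :=
    tendsto_pi_nhds.1 h x
  exact tendsto_pi_nhds.1 hx y

include hAdm hlap he hG hschur hL1 hω hl hβ hT in
/-- **Fixed-`N` existence of the Schur complement modulo non-degeneracy of `G₀`.** For admissible `f, g` and
`det G₀ ≠ 0`: `schur_s(f,g) → ∫₀^∞corr(f,g) − Σ_{x,y} ∫₀^∞corr(f,e_x)·(G₀⁻¹)_{xy}·∫₀^∞corr(e_y,g)`. [folklore] -/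
theorem tendsto_schur_of_det_ne_zero {f g : PhaseSpace N → ℝ} (hf : Adm f) (hg : Adm g)
    (G₀ : Matrix (Fin N) (Fin N) ℝ) (hG₀ : ∀ x y, G₀ x y = ∫ t in Set.Ioi (0 : ℝ), corr (e x) (e y) t)
    (hdet : G₀.det ≠ 0) :
    Tendsto (fun s => schur s f g) (nhdsWithin (0 : ℝ) (Set.Ioi 0))
      (nhds ((∫ t in Set.Ioi (0 : ℝ), corr f g t) -
        ∑ x, ∑ y, (∫ t in Set.Ioi (0 : ℝ), corr f (e x) t) * G₀⁻¹ x y *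
          (∫ t in Set.Ioi (0 : ℝ), corr (e y) g t))) := by
  have hfun : (fun s => schur s f g) =
      fun s => lap s f g - ∑ x, ∑ y, lap s f (e x) * (G s)⁻¹ x y * lap s (e y) g :=
    funext fun s => hschur s f g
  rw [hfun]
  refine (tendsto_lap_of_adm hlap hL1 hf hg).sub ?_
  refine tendsto_finsetSum _ fun x _ => tendsto_finsetSum _ fun y _ => ?_
  exact ((tendsto_lap_of_adm hlap hL1 hf (adm_e Adm hAdm e he hω hl hβ hT x)).mul
    (tendsto_inv_G hAdm hlap he hG hL1 hω hl hβ hT G₀ hG₀ hdet x y)).mul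
    (tendsto_lap_of_adm hlap hL1 (adm_e Adm hAdm e he hω hl hβ hT y) hg)

end Package

/-! ## §2' The canonical instance: the orthogonal DC responses exist at fixed `N` whenever `det G₀ ≠ 0` -/

/-- **FixedNLap modulo non-degeneracy (canonical gadgets of the route).** For `pinnedChain ω₂ lam β γ` (all `> 0`),
`T > 0`, `N ≥ 2`: if the matrix `G₀ = [∫₀^∞corr(e_x,e_y)]` of time-integrated site-energy correlations has
`det G₀ ≠ 0`, then for EVERY `b : Fin N` the orthogonal-dynamics DC response exists:
`schur_s(j_b, J) → schur₀(j_b, J) = ∫₀^∞corr(j_b,J) − Σ_{x,y}∫₀^∞corr(j_b,e_x)·(G₀⁻¹)_{xy}·∫₀^∞corr(e_y,J)` as `s ↓ 0`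
(`corr ∈ L¹(0,∞)` from the landed `FeshbachIdentities`, `stub_feshbachIdentities`). [folklore] -/
theorem tendsto_schur_bond (ω₂ lam β γ : ℝ) (hω : 0 < ω₂) (hl : 0 < lam) (hβ : 0 < β) (hγ : 0 < γ)
    (T : ℝ) (hT : 0 < T) (N : ℕ) (hN : 2 ≤ N) :
    let P := Literature.MathematicalPhysics.KineticTheory.HeatConduction.pinnedChain ω₂ lam β γ
    let X := Literature.MathematicalPhysics.KineticTheory.HeatConduction.PhaseSpace N
    let μ : MeasureTheory.Measure X := P.gibbsMeasure N T
    let corr : (X → ℝ) → (X → ℝ) → ℝ → ℝ := fun f g t =>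
      (∫ z, f z * (∫ y, g y ∂(P.transitionKernel N T T t.toNNReal z)) ∂μ) - (∫ z, f z ∂μ) * (∫ z, g z ∂μ)
    let lap : ℝ → (X → ℝ) → (X → ℝ) → ℝ := fun s f g =>
      ∫ t in Set.Ioi (0 : ℝ), Real.exp (-(s * t)) * corr f g t
    let e : Fin N → X → ℝ := fun x z => z.2 x ^ 2 / 2 + P.U (z.1 x) +
      ∑ j : Fin N, ((if j.val = x.val + 1 then P.V (z.1 j - z.1 x) / 2 else 0) +
        (if x.val = j.val + 1 then P.V (z.1 x - z.1 j) / 2 else 0))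
    let G : ℝ → Matrix (Fin N) (Fin N) ℝ := fun s => Matrix.of fun x y => lap s (e x) (e y)
    let schur : ℝ → (X → ℝ) → (X → ℝ) → ℝ := fun s f g =>
      lap s f g - ∑ x : Fin N, ∑ y : Fin N, lap s f (e x) * (G s)⁻¹ x y * lap s (e y) g
    let J : X → ℝ := fun z => ∑ i : Fin N, P.bondCurrent N i z
    let G₀ : Matrix (Fin N) (Fin N) ℝ := Matrix.of fun x y => ∫ t in Set.Ioi (0 : ℝ), corr (e x) (e y) t
    let schur₀ : (X → ℝ) → (X → ℝ) → ℝ := fun f g =>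
      (∫ t in Set.Ioi (0 : ℝ), corr f g t) -
        ∑ x : Fin N, ∑ y : Fin N, (∫ t in Set.Ioi (0 : ℝ), corr f (e x) t) * G₀⁻¹ x y *
          (∫ t in Set.Ioi (0 : ℝ), corr (e y) g t)
    G₀.det ≠ 0 → ∀ b : Fin N,
      Filter.Tendsto (fun s => schur s (P.bondCurrent N b) J) (nhdsWithin (0 : ℝ) (Set.Ioi 0))
        (nhds (schur₀ (P.bondCurrent N b) J)) := by
  intro P X μ corr lap e G schur J G₀ schur₀ hdet b
  obtain ⟨-, hFI2, -, -⟩ :=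
    Summit.AtomisticToContinuum.FouriersLaw.Theorems.HonestZwanzig.stub_feshbachIdentities
      ω₂ lam β γ hω hl hβ hγ T hT N hN
  exact tendsto_schur_of_det_ne_zero (ω₂ := ω₂) (lam := lam) (β := β) (γ := γ) (N := N) (T := T)
    (Adm := fun f => Continuous f ∧ ∃ A : ℝ, ∀ z,
      |f z| ≤ A * Real.exp ((pinnedChain ω₂ lam β γ).hamiltonian N z / (8 * T)))
    (corr := corr) (lap := lap) (e := e) (G := G) (schur := schur)
    (fun f => Iff.rfl) (fun s f g => rfl) (fun x z => rfl) (fun s x y => rfl) (fun s f g => rfl)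
    (fun f g hf hg => (hFI2 f g hf hg).2.2.1) hω hl.le hβ.le hT
    (adm_bondCurrent _ (fun f => Iff.rfl) hω hl.le hβ.le hT b)
    (adm_totalCurrent _ (fun f => Iff.rfl) hω hl.le hβ.le hT) G₀ (fun x y => rfl) hdet

/-! ## §1 + §3 The existence barrier and the kill switches -/

/-- **Kill switch (the shape every refutation must deliver).** If at ONE admissible parameter point, for every
`k₀ > 0` and every margin `R` there are `N ≥ 2`, an `R`-bulk bond `b` and a LIMIT `ρ = lim_{s↓0} schur_s(j_b, J)` with
`ρ < k₀`, then `PositiveMemory` is false. (The converse is the literal negation of the crux: a non-existent limit never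
refutes it.) [folklore] -/
theorem not_positiveMemory_of_witness
    (h : ∃ ω₂ lam β γ : ℝ, 0 < ω₂ ∧ 0 < lam ∧ 0 < β ∧ 0 < γ ∧ ∃ T : ℝ, 0 < T ∧
      ∀ k₀ : ℝ, 0 < k₀ → ∀ R : ℕ, ∃ N : ℕ, 2 ≤ N ∧
      let P := Literature.MathematicalPhysics.KineticTheory.HeatConduction.pinnedChain ω₂ lam β γ
      let X := Literature.MathematicalPhysics.KineticTheory.HeatConduction.PhaseSpace N
      let μ : MeasureTheory.Measure X := P.gibbsMeasure N T
      let corr : (X → ℝ) → (X → ℝ) → ℝ → ℝ := fun f g t =>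
        (∫ z, f z * (∫ y, g y ∂(P.transitionKernel N T T t.toNNReal z)) ∂μ) - (∫ z, f z ∂μ) * (∫ z, g z ∂μ)
      let lap : ℝ → (X → ℝ) → (X → ℝ) → ℝ := fun s f g =>
        ∫ t in Set.Ioi (0 : ℝ), Real.exp (-(s * t)) * corr f g t
      let e : Fin N → X → ℝ := fun x z => z.2 x ^ 2 / 2 + P.U (z.1 x) +
        ∑ j : Fin N, ((if j.val = x.val + 1 then P.V (z.1 j - z.1 x) / 2 else 0) +
          (if x.val = j.val + 1 then P.V (z.1 x - z.1 j) / 2 else 0))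
      let G : ℝ → Matrix (Fin N) (Fin N) ℝ := fun s => Matrix.of fun x y => lap s (e x) (e y)
      let schur : ℝ → (X → ℝ) → (X → ℝ) → ℝ := fun s f g =>
        lap s f g - ∑ x : Fin N, ∑ y : Fin N, lap s f (e x) * (G s)⁻¹ x y * lap s (e y) g
      let J : X → ℝ := fun z => ∑ i : Fin N, P.bondCurrent N i z
      ∃ b : Fin N, R ≤ b.val ∧ b.val + 2 + R ≤ N ∧ ∃ ρ : ℝ, ρ < k₀ ∧
        Filter.Tendsto (fun s => schur s (P.bondCurrent N b) J) (nhdsWithin (0 : ℝ) (Set.Ioi 0)) (nhds ρ)) :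
    ¬ Summit.AtomisticToContinuum.FouriersLaw.Theses.HonestZwanzig.PositiveMemory := by
  intro hPM
  obtain ⟨ω₂, lam, β, γ, hω, hl, hβ, hγ, T, hT, hw⟩ := h
  obtain ⟨k₀, hk₀, R, hR⟩ := hPM ω₂ lam β γ hω hl hβ hγ T hT
  obtain ⟨N, hN, hwN⟩ := hw k₀ hk₀ R
  have key := hR N hN
  dsimp only at key hwN
  obtain ⟨b, hb1, hb2, ρ, hρ, hten⟩ := hwN
  have := key b hb1 hb2 ρ hten
  linarith

/-- **Kill switch modulo fixed-`N` non-degeneracy (existence-free).** If at ONE admissible parameter point, for every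
`k₀ > 0` and every margin `R` there is `N ≥ 2` with `det G₀ ≠ 0` (`G₀ = [∫₀^∞corr(e_x,e_y)]`) and an `R`-bulk bond `b`
whose explicit finite-`N` Schur complement `schur₀(j_b, J) = ∫₀^∞corr(j_b,J) − Σ∫₀^∞corr(j_b,e_x)(G₀⁻¹)_{xy}∫₀^∞corr(e_y,J)`
is `< k₀`, then `PositiveMemory` is false — the limit is produced by `tendsto_schur_bond`. [folklore] -/
theorem not_positiveMemory_of_schur₀_witness
    (h : ∃ ω₂ lam β γ : ℝ, 0 < ω₂ ∧ 0 < lam ∧ 0 < β ∧ 0 < γ ∧ ∃ T : ℝ, 0 < T ∧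
      ∀ k₀ : ℝ, 0 < k₀ → ∀ R : ℕ, ∃ N : ℕ, 2 ≤ N ∧
      let P := Literature.MathematicalPhysics.KineticTheory.HeatConduction.pinnedChain ω₂ lam β γ
      let X := Literature.MathematicalPhysics.KineticTheory.HeatConduction.PhaseSpace N
      let μ : MeasureTheory.Measure X := P.gibbsMeasure N T
      let corr : (X → ℝ) → (X → ℝ) → ℝ → ℝ := fun f g t =>
        (∫ z, f z * (∫ y, g y ∂(P.transitionKernel N T T t.toNNReal z)) ∂μ) - (∫ z, f z ∂μ) * (∫ z, g z ∂μ)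
      let e : Fin N → X → ℝ := fun x z => z.2 x ^ 2 / 2 + P.U (z.1 x) +
        ∑ j : Fin N, ((if j.val = x.val + 1 then P.V (z.1 j - z.1 x) / 2 else 0) +
          (if x.val = j.val + 1 then P.V (z.1 x - z.1 j) / 2 else 0))
      let J : X → ℝ := fun z => ∑ i : Fin N, P.bondCurrent N i z
      let G₀ : Matrix (Fin N) (Fin N) ℝ := Matrix.of fun x y => ∫ t in Set.Ioi (0 : ℝ), corr (e x) (e y) t
      let schur₀ : (X → ℝ) → (X → ℝ) → ℝ := fun f g =>
        (∫ t in Set.Ioi (0 : ℝ), corr f g t) -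
          ∑ x : Fin N, ∑ y : Fin N, (∫ t in Set.Ioi (0 : ℝ), corr f (e x) t) * G₀⁻¹ x y *
            (∫ t in Set.Ioi (0 : ℝ), corr (e y) g t)
      G₀.det ≠ 0 ∧ ∃ b : Fin N, R ≤ b.val ∧ b.val + 2 + R ≤ N ∧ schur₀ (P.bondCurrent N b) J < k₀) :
    ¬ Summit.AtomisticToContinuum.FouriersLaw.Theses.HonestZwanzig.PositiveMemory := by
  refine not_positiveMemory_of_witness ?_
  obtain ⟨ω₂, lam, β, γ, hω, hl, hβ, hγ, T, hT, hw⟩ := h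
  refine ⟨ω₂, lam, β, γ, hω, hl, hβ, hγ, T, hT, fun k₀ hk₀ R => ?_⟩
  obtain ⟨N, hN, hwN⟩ := hw k₀ hk₀ R
  refine ⟨N, hN, ?_⟩
  have hex := tendsto_schur_bond ω₂ lam β γ hω hl hβ hγ T hT N hN
  dsimp only at hwN hex ⊢
  obtain ⟨hdet, b, hb1, hb2, hlt⟩ := hwN
  exact ⟨b, hb1, hb2, _, hlt, hex hdet b⟩

/-- **The existence-free form of the crux.** Under fixed-`N` non-degeneracy of `G₀` at every admissible point
(the planner's "FixedNLap"), `PositiveMemory` is EQUIVALENT to: `∃ k₀ > 0, ∃ R, ∀ N ≥ 2, ∀ R`-bulk `b`,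
`k₀ ≤ schur₀(j_b, J)` — an `N`-uniform floor for an explicit finite-`N` number (uniqueness of limits in the `NeBot`
filter `𝓝[>] 0`). [folklore] -/
theorem positiveMemory_iff_schur₀Floor
    (hnd : ∀ ω₂ lam β γ : ℝ, 0 < ω₂ → 0 < lam → 0 < β → 0 < γ → ∀ T : ℝ, 0 < T → ∀ N : ℕ, 2 ≤ N →
      let P := Literature.MathematicalPhysics.KineticTheory.HeatConduction.pinnedChain ω₂ lam β γ
      let X := Literature.MathematicalPhysics.KineticTheory.HeatConduction.PhaseSpace N
      let μ : MeasureTheory.Measure X := P.gibbsMeasure N T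
      let corr : (X → ℝ) → (X → ℝ) → ℝ → ℝ := fun f g t =>
        (∫ z, f z * (∫ y, g y ∂(P.transitionKernel N T T t.toNNReal z)) ∂μ) - (∫ z, f z ∂μ) * (∫ z, g z ∂μ)
      let e : Fin N → X → ℝ := fun x z => z.2 x ^ 2 / 2 + P.U (z.1 x) +
        ∑ j : Fin N, ((if j.val = x.val + 1 then P.V (z.1 j - z.1 x) / 2 else 0) +
          (if x.val = j.val + 1 then P.V (z.1 x - z.1 j) / 2 else 0))
      let G₀ : Matrix (Fin N) (Fin N) ℝ := Matrix.of fun x y => ∫ t in Set.Ioi (0 : ℝ), corr (e x) (e y) t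
      G₀.det ≠ 0) :
    Summit.AtomisticToContinuum.FouriersLaw.Theses.HonestZwanzig.PositiveMemory ↔
    (∀ ω₂ lam β γ : ℝ, 0 < ω₂ → 0 < lam → 0 < β → 0 < γ → ∀ T : ℝ, 0 < T → ∃ k₀ : ℝ, 0 < k₀ ∧ ∃ R : ℕ,
      ∀ N : ℕ, 2 ≤ N →
      let P := Literature.MathematicalPhysics.KineticTheory.HeatConduction.pinnedChain ω₂ lam β γ
      let X := Literature.MathematicalPhysics.KineticTheory.HeatConduction.PhaseSpace N
      let μ : MeasureTheory.Measure X := P.gibbsMeasure N T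
      let corr : (X → ℝ) → (X → ℝ) → ℝ → ℝ := fun f g t =>
        (∫ z, f z * (∫ y, g y ∂(P.transitionKernel N T T t.toNNReal z)) ∂μ) - (∫ z, f z ∂μ) * (∫ z, g z ∂μ)
      let e : Fin N → X → ℝ := fun x z => z.2 x ^ 2 / 2 + P.U (z.1 x) +
        ∑ j : Fin N, ((if j.val = x.val + 1 then P.V (z.1 j - z.1 x) / 2 else 0) +
          (if x.val = j.val + 1 then P.V (z.1 x - z.1 j) / 2 else 0))
      let J : X → ℝ := fun z => ∑ i : Fin N, P.bondCurrent N i z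
      let G₀ : Matrix (Fin N) (Fin N) ℝ := Matrix.of fun x y => ∫ t in Set.Ioi (0 : ℝ), corr (e x) (e y) t
      let schur₀ : (X → ℝ) → (X → ℝ) → ℝ := fun f g =>
        (∫ t in Set.Ioi (0 : ℝ), corr f g t) -
          ∑ x : Fin N, ∑ y : Fin N, (∫ t in Set.Ioi (0 : ℝ), corr f (e x) t) * G₀⁻¹ x y *
            (∫ t in Set.Ioi (0 : ℝ), corr (e y) g t)
      ∀ b : Fin N, R ≤ b.val → b.val + 2 + R ≤ N → k₀ ≤ schur₀ (P.bondCurrent N b) J) := by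
  constructor
  · intro hPM ω₂ lam β γ hω hl hβ hγ T hT
    obtain ⟨k₀, hk₀, R, hR⟩ := hPM ω₂ lam β γ hω hl hβ hγ T hT
    refine ⟨k₀, hk₀, R, fun N hN => ?_⟩
    have key := hR N hN
    have hex := tendsto_schur_bond ω₂ lam β γ hω hl hβ hγ T hT N hN
    have hdet := hnd ω₂ lam β γ hω hl hβ hγ T hT N hN
    dsimp only at key hex hdet ⊢
    intro b hb1 hb2
    exact key b hb1 hb2 _ (hex hdet b)
  · intro h ω₂ lam β γ hω hl hβ hγ T hT
    obtain ⟨k₀, hk₀, R, hR⟩ := h ω₂ lam β γ hω hl hβ hγ T hT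
    refine ⟨k₀, hk₀, R, fun N hN => ?_⟩
    have key := hR N hN
    have hex := tendsto_schur_bond ω₂ lam β γ hω hl hβ hγ T hT N hN
    have hdet := hnd ω₂ lam β γ hω hl hβ hγ T hT N hN
    dsimp only at key hex hdet ⊢
    intro b hb1 hb2 ρ hρ
    have huniq : ρ = _ := tendsto_nhds_unique hρ (hex hdet b)
    rw [huniq]
    exact key b hb1 hb2

end Summit.AtomisticToContinuum.FouriersLaw.Theorems.PositiveMemory.Negative.ExistenceBarrier

end
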